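import Summits.Schanuel.Schanuel.Theses.RoyCriterion
import Literature.Barriers.Schanuel.AlgebraicIndependenceOfLogarithms
import Literature.Barriers.Schanuel.LargeTranscendenceDegreeSmallTrdegProofs

/-!
# Crux-triage r1 k3 — evidence file for stmt-Schanuel-0069 (`SchanuelTwo`)

Triager `refuter-cruxtri-stmt-Schanuel-0069-r1-3-0`. Cheap Lean checks behind the verdicts of
`TRIAGE-r1-3.md`:

* §A (card `hl-collapse-line-purity`): two "line purity" renderings of the crux —
  `LinePurity'` (pairs of depth-one seeds) and `FieldLinePurity` (a field of transcendence
  degree `≤ 1` contains no `ℚ`-independent pair of logarithms of its own elements) — are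
  EQUIVALENT to `SchanuelTwo` in a few lines each: the reformulation carries the crux verbatim.
* §B (card `failure-line-pencil-rigidity`): the gonality-one / affine–rational sector of
  failures (`x = (α, t)`, `α ∈ ℚ̄`, `e^α, e^t ∈ ℚ̄(t)`) consists of failures, and its emptiness
  ALREADY implies the transcendence of `e^e` (witness `x = (1, e)` if `e^e ∈ ℚ̄`), an open problem.
* §C (both cards): `failure_conj_iff` — the failure set is stable under complex conjugation
  (an `exp`-commuting `ℚ`-algebra automorphism); the "conjugation shadow" is bookkeeping.
* §D (atlas): `schanuelTwo_imp_e_lambertW` — the mixed cell (1, Ω), Ω e^Ω = 1, of the seed-type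
  atlas is the open problem "e ⊥ W(1)".
-/

set_option linter.dupNamespace false

noncomputable section

open Complex IntermediateField
open scoped ComplexConjugate
open Literature.Barriers.Schanuel (trdeg_mono trdeg_adjoin_singleton_le_one
  trdeg_adjoin_union_eq_of_isAlgebraic)
open Summit.Schanuel.Schanuel.Theses.RoyCriterion (SchanuelTwo)

namespace Summit.Schanuel.Schanuel.Cruxes.SchanuelTwo.Triage3

/-! ### §0 Bookkeeping (the first three items are copied from the disprover's `Disproof.lean`,
whose published module was not yet built on the farm when this file was checked) -/

/-- The Schanuel field `ℚ(x, e^x)` of a pair (as in `Disproof.lean`). -/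
abbrev SF (x : Fin 2 → ℂ) : IntermediateField ℚ ℂ :=
  adjoin ℚ (Set.range x ∪ Set.range (Complex.exp ∘ x))

/-- `SF x ≤ L` from membership of the four generators (as in `Disproof.lean`). -/
theorem SF_le {x : Fin 2 → ℂ} {L : IntermediateField ℚ ℂ} (h0 : x 0 ∈ L) (h1 : x 1 ∈ L)
    (e0 : cexp (x 0) ∈ L) (e1 : cexp (x 1) ∈ L) : SF x ≤ L := by
  rw [adjoin_le_iff]
  rintro z (⟨i, rfl⟩ | ⟨i, rfl⟩)
  · fin_cases i
    · exact h0
    · exact h1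
  · fin_cases i
    · exact e0
    · exact e1

/-- `(1, e)` is `ℚ`-linearly independent (as in `Disproof.lean`). -/
theorem linearIndependent_one_exp_one : LinearIndependent ℚ ![(1 : ℂ), cexp 1] :=
  (Literature.Barriers.Schanuel.linearIndependent_pair_of_transcendental
    (Literature.NumberTheory.Transcendental.transcendental_exp_holds
      (isAlgebraic_one (R := ℚ) (A := ℂ)) one_ne_zero)).2


theorem le_one_of_not_two_le {t : Cardinal} (h : ¬ (2 : Cardinal) ≤ t) : t ≤ 1 := by
  have ht2 : t < 2 := not_le.mp h
  have h2al : (2 : Cardinal) < Cardinal.aleph0 := by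
    exact_mod_cast Cardinal.natCast_lt_aleph0 (n := 2)
  obtain ⟨n, rfl⟩ := Cardinal.lt_aleph0.1 (ht2.trans h2al)
  have h2' : n < 2 := by exact_mod_cast ht2
  have : n ≤ 1 := by omega
  exact_mod_cast this

theorem not_two_le_one : ¬ (2 : Cardinal) ≤ 1 := fun h => Nat.not_ofNat_le_one h

/-! ### §A "Line purity" renderings are the crux verbatim -/

/-- The one-seed field `ℚ(a, e^a)`. -/
abbrev SF₁ (a : ℂ) : IntermediateField ℚ ℂ := adjoin ℚ ({a, cexp a} : Set ℂ)

theorem SF₁_le_SF (x : Fin 2 → ℂ) (i : Fin 2) : SF₁ (x i) ≤ SF x := by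
  rw [adjoin_le_iff]
  rintro z (rfl | hz)
  · exact subset_adjoin ℚ _ (Or.inl ⟨i, rfl⟩)
  · rw [Set.mem_singleton_iff.mp hz]
    exact subset_adjoin ℚ _ (Or.inr ⟨i, rfl⟩)

/-- A *depth-one seed*: a point whose own Hermite–Lindemann field does not already carry two
independent transcendentals (`trdeg ℚ(a, e^a) ≤ 1`; `= 1` when `a ≠ 0`). -/
def DepthOne' (a : ℂ) : Prop := ¬ (2 : Cardinal) ≤ Algebra.trdeg ℚ (SF₁ a)

/-- "Line purity" on pairs of seeds: two `ℚ`-independent depth-one seeds never share their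
transcendental. -/
def LinePurity' : Prop :=
  ∀ x : Fin 2 → ℂ, DepthOne' (x 0) → DepthOne' (x 1) → LinearIndependent ℚ x →
    (2 : Cardinal) ≤ Algebra.trdeg ℚ (SF x)

/-- `LinePurity' ↔ SchanuelTwo` (the non-depth-one cases are settled by monotonicity alone). -/
theorem linePurity'_iff : LinePurity' ↔ SchanuelTwo := by
  constructor
  · intro h x hx
    by_cases h0 : DepthOne' (x 0)
    · by_cases h1 : DepthOne' (x 1)
      · exact h x h0 h1 hx
      · exact (not_not.mp h1).trans (trdeg_mono (SF₁_le_SF x 1))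
    · exact (not_not.mp h0).trans (trdeg_mono (SF₁_le_SF x 0))
  · intro h x _ _ hx
    exact h x hx

/-- "Line purity" as a statement about ONE field: a subfield of `ℂ` of transcendence degree
`≤ 1` contains no `ℚ`-linearly independent pair `x₀, x₁` together with `e^{x₀}, e^{x₁}`
(equivalently: for `K` algebraically closed of trdeg `1`, `dim_ℚ (K ∩ exp⁻¹ K) ≤ 1`). -/
def FieldLinePurity : Prop :=
  ∀ K : IntermediateField ℚ ℂ, Algebra.trdeg ℚ K ≤ 1 →
    ∀ x : Fin 2 → ℂ, (∀ i, x i ∈ K) → (∀ i, cexp (x i) ∈ K) → ¬ LinearIndependent ℚ x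

/-- `FieldLinePurity ↔ SchanuelTwo`. -/
theorem fieldLinePurity_iff : FieldLinePurity ↔ SchanuelTwo := by
  constructor
  · intro h x hx
    by_contra hlt
    have hle : Algebra.trdeg ℚ (SF x) ≤ 1 := le_one_of_not_two_le hlt
    exact h (SF x) hle x (fun i => subset_adjoin ℚ _ (Or.inl ⟨i, rfl⟩))
      (fun i => subset_adjoin ℚ _ (Or.inr ⟨i, rfl⟩)) hx
  · intro h K hK x hxK heK hx
    have h2 := h x hx
    have hle : SF x ≤ K := SF_le (hxK 0) (hxK 1) (heK 0) (heK 1)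
    exact not_two_le_one ((h2.trans (trdeg_mono hle)).trans hK)

/-! ### §B The gonality-one ("affine–rational") sector already contains the transcendence of `e^e` -/

/-- `ℚ̄(t)` as a subfield of `ℂ` (`ℚ` adjoined `t` and all algebraic numbers). -/
abbrev QbarAdj (t : ℂ) : IntermediateField ℚ ℂ :=
  adjoin ℚ (({t} : Set ℂ) ∪ ((algebraicClosure ℚ ℂ : IntermediateField ℚ ℂ) : Set ℂ))

theorem trdeg_QbarAdj_le_one (t : ℂ) : Algebra.trdeg ℚ (QbarAdj t) ≤ 1 := by
  have h := trdeg_adjoin_union_eq_of_isAlgebraic ({t} : Set ℂ)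
    ((algebraicClosure ℚ ℂ : IntermediateField ℚ ℂ) : Set ℂ)
    (fun z hz => (mem_algebraicClosure_iff.mp hz))
  exact h.trans_le (trdeg_adjoin_singleton_le_one t)

/-- The affine–rational (gonality-one) sector of failures: `x = (α, t)` with `α` algebraic, `t`
transcendental, `x` `ℚ`-linearly independent, and both exponentials `e^α, e^t` in `ℚ̄(t)` — so all
four coordinates of `(x, e^x)` are rational functions of the single transcendental `t`. -/
def AffineRationalFailure (x : Fin 2 → ℂ) : Prop :=
  LinearIndependent ℚ x ∧ IsAlgebraic ℚ (x 0) ∧ Transcendental ℚ (x 1) ∧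
    cexp (x 0) ∈ QbarAdj (x 1) ∧ cexp (x 1) ∈ QbarAdj (x 1)

/-- Every point of the sector IS a failure of the crux (`ℚ(x, e^x) ⊆ ℚ̄(t)` has trdeg `≤ 1`). -/
theorem not_two_le_trdeg_of_affineRationalFailure {x : Fin 2 → ℂ} (h : AffineRationalFailure x) :
    ¬ (2 : Cardinal) ≤ Algebra.trdeg ℚ (SF x) := by
  obtain ⟨_, halg, _, he0, he1⟩ := h
  have hle : SF x ≤ QbarAdj (x 1) := by
    refine SF_le ?_ ?_ he0 he1
    · exact subset_adjoin ℚ _ (Or.inr (mem_algebraicClosure_iff.mpr halg))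
    · exact subset_adjoin ℚ _ (Or.inl rfl)
  intro h2
  exact not_two_le_one ((h2.trans (trdeg_mono hle)).trans (trdeg_QbarAdj_le_one _))

/-- Hence the sector is empty under the crux … -/
theorem no_affineRationalFailure_of_schanuelTwo (hS : SchanuelTwo) (x : Fin 2 → ℂ) :
    ¬ AffineRationalFailure x :=
  fun h => not_two_le_trdeg_of_affineRationalFailure h (hS x h.1)

/-- … and conversely **emptiness of the gonality-one sector already yields the transcendence of
`e^e`** (OPEN — not even the irrationality of `e^e` is known): if `e^e ∈ ℚ̄` then `x = (1, e)`
lies in the sector (`t = e`, `e^1 = t`, `e^t ∈ ℚ̄ ⊆ ℚ̄(t)`). So the "`d = 1`" first rung of the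
pencil-rigidity card is not a cheap lemma. -/
theorem transcendental_exp_exp_one_of_no_affineRationalFailure
    (h : ∀ x : Fin 2 → ℂ, ¬ AffineRationalFailure x) :
    Transcendental ℚ (cexp (cexp 1)) := by
  intro halg
  refine h ![(1 : ℂ), cexp 1] ⟨linearIndependent_one_exp_one, ?_, ?_, ?_, ?_⟩
  · simpa using isAlgebraic_one
  · simpa using Literature.NumberTheory.Transcendental.transcendental_exp_holds
      (isAlgebraic_one (R := ℚ) (A := ℂ)) one_ne_zero
  · simp only [Matrix.cons_val_zero, Matrix.cons_val_one]
    exact subset_adjoin ℚ _ (Or.inl rfl)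
  · simp only [Matrix.cons_val_one]
    exact subset_adjoin ℚ _ (Or.inr (mem_algebraicClosure_iff.mpr halg))

/-- The same witness in the crux's own currency: `e^e ∈ ℚ̄` would refute `SchanuelTwo` outright
(contrapositive of the disprover's `schanuelTwo_imp_e_exp_e`, recorded for the triage). -/
theorem transcendental_exp_exp_one_of_schanuelTwo (hS : SchanuelTwo) :
    Transcendental ℚ (cexp (cexp 1)) :=
  transcendental_exp_exp_one_of_no_affineRationalFailure (no_affineRationalFailure_of_schanuelTwo hS)

/-! ### §C (both ideator-3 cards) The "conjugation shadow" is bookkeeping: the failure set is `conj`-stable -/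

/-- Complex conjugation as a `ℚ`-algebra automorphism of `ℂ`. -/
def conjQ : ℂ ≃ₐ[ℚ] ℂ := Complex.conjAe.restrictScalars ℚ

@[simp] theorem conjQ_apply (z : ℂ) : conjQ z = conj z := rfl

theorem SF_map_conjQ (x : Fin 2 → ℂ) :
    (SF x).map (conjQ : ℂ ≃ₐ[ℚ] ℂ).toAlgHom = SF (conj ∘ x) := by
  simp only [SF, adjoin_map]
  congr 1
  ext z
  simp only [Set.image_union, Set.mem_union, Set.mem_image, Set.mem_range, Function.comp_apply]
  constructor
  · rintro (⟨w, ⟨i, rfl⟩, rfl⟩ | ⟨w, ⟨i, rfl⟩, rfl⟩)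
    · exact Or.inl ⟨i, rfl⟩
    · exact Or.inr ⟨i, by rw [Complex.exp_conj]; rfl⟩
  · rintro (⟨i, rfl⟩ | ⟨i, rfl⟩)
    · exact Or.inl ⟨x i, ⟨i, rfl⟩, rfl⟩
    · exact Or.inr ⟨cexp (x i), ⟨i, rfl⟩, by rw [Complex.exp_conj]; rfl⟩

/-- **Conjugation invariance of `trdeg ℚ(x, e^x)`** (`conj` is an `exp`-commuting field
automorphism). -/
theorem trdeg_SF_conj (x : Fin 2 → ℂ) :
    Algebra.trdeg ℚ (SF (conj ∘ x)) = Algebra.trdeg ℚ (SF x) := by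
  rw [← SF_map_conjQ]
  exact ((SF x).equivMap (conjQ : ℂ ≃ₐ[ℚ] ℂ).toAlgHom).trdeg_eq.symm

theorem linearIndependent_conj_iff (x : Fin 2 → ℂ) :
    LinearIndependent ℚ (conj ∘ x) ↔ LinearIndependent ℚ x := by
  have key : ∀ y : Fin 2 → ℂ, LinearIndependent ℚ y → LinearIndependent ℚ (conj ∘ y) := by
    intro y hy
    exact hy.map' ((conjQ : ℂ ≃ₐ[ℚ] ℂ).toLinearEquiv.toLinearMap) (LinearEquiv.ker _)
  refine ⟨fun h => ?_, key x⟩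
  have := key _ h
  have hcc : conj ∘ (conj ∘ x) = x := by
    funext i; simp
  rwa [hcc] at this

/-- `failure_conj` of the cards' Sketch, PROVED: `x` fails the crux iff `conj ∘ x` does (so a
failing plane may be normalised to be `conj`-stable-or-moved, nothing more). -/
theorem failure_conj_iff (x : Fin 2 → ℂ) :
    (LinearIndependent ℚ (conj ∘ x) ∧ ¬ (2 : Cardinal) ≤ Algebra.trdeg ℚ (SF (conj ∘ x))) ↔
      (LinearIndependent ℚ x ∧ ¬ (2 : Cardinal) ≤ Algebra.trdeg ℚ (SF x)) := by
  rw [linearIndependent_conj_iff, trdeg_SF_conj]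

/-! ### §D One more cell of the seed-type atlas: the (E, M) pair `(1, Ω)`, `Ω e^Ω = 1` (Lambert `W(1)`) -/

/-- A solution of `Ω e^Ω = 1` is transcendental (if `Ω ∈ ℚ̄` then `Ω ≠ 0` and `e^Ω = Ω⁻¹ ∈ ℚ̄`,
against Hermite–Lindemann). -/
theorem transcendental_of_mul_exp_eq_one {Ω : ℂ} (hΩ : Ω * cexp Ω = 1) : Transcendental ℚ Ω := by
  intro halg
  have hΩ0 : Ω ≠ 0 := by
    rintro rfl
    simp at hΩ
  have hexp : cexp Ω = Ω⁻¹ := by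
    field_simp
    simpa [mul_comm] using hΩ
  exact Literature.NumberTheory.Transcendental.transcendental_exp_holds halg hΩ0
    (by rw [hexp]; exact halg.inv)

/-- **`SchanuelTwo ⟹ e and W(1) are algebraically independent`** (seed types E = `1` and
M = `Ω`, `Ω e^Ω = 1`; `ℚ(1, Ω, e, e^Ω) = ℚ(e, Ω)`). OPEN, like every mixed cell of the atlas;
recorded as a further sufficient refutation target for the disprover. -/
theorem schanuelTwo_imp_e_lambertW (hS : SchanuelTwo) {Ω : ℂ} (hΩ : Ω * cexp Ω = 1) :
    AlgebraicIndependent ℚ ![cexp 1, Ω] := by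
  have hΩ0 : Ω ≠ 0 := by
    rintro rfl
    simp at hΩ
  have hexp : cexp Ω = Ω⁻¹ := by
    field_simp
    simpa [mul_comm] using hΩ
  have hli : LinearIndependent ℚ ![(1 : ℂ), Ω] :=
    (Literature.Barriers.Schanuel.linearIndependent_pair_of_transcendental
      (transcendental_of_mul_exp_eq_one hΩ)).2
  have h2 := hS _ hli
  have hΩmem : Ω ∈ adjoin ℚ (Set.range ![cexp 1, Ω]) :=
    subset_adjoin ℚ (Set.range ![cexp 1, Ω]) ⟨1, rfl⟩
  have hemem : cexp 1 ∈ adjoin ℚ (Set.range ![cexp 1, Ω]) :=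
    subset_adjoin ℚ (Set.range ![cexp 1, Ω]) ⟨0, rfl⟩
  have hle : SF ![(1 : ℂ), Ω] ≤ adjoin ℚ (Set.range ![cexp 1, Ω]) := by
    refine SF_le ?_ ?_ ?_ ?_
    · simp
    · simpa using hΩmem
    · simpa using hemem
    · change cexp Ω ∈ adjoin ℚ (Set.range ![cexp 1, Ω])
      rw [hexp]
      exact inv_mem hΩmem
  exact Literature.Barriers.Schanuel.algebraicIndependent_of_le_trdeg_adjoin _
    (by exact_mod_cast h2.trans (trdeg_mono hle))

end Summit.Schanuel.Schanuel.Cruxes.SchanuelTwo.Triage3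

end
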